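import Summits.BirchSwinnertonDyer.BirchSwinnertonDyer.Theorems.CyclotomicUntwistFiniteSlopeValueAtOne
import Mathlib.Analysis.Normed.Group.Ultra
import HarnessLib

/-!
# The untwist sits in the `3`-adic SPECTRAL HALO: its weight-character is at distance exactly `3^{-1/2}`
# from every classical weight — kernel certificate of the obstruction to the nearest printed `p`-adic
# Gross–Zagier formula (Büyükboduk–Pollack–Sasaki 2018 Thm 1.1.11) for crux K1 `PSRankOneLowerHalfAtThree`

Cell `pub/bsd-wall` (D-0145 line `route-BirchSwinnertonDyer-CyclotomicUntwist`), seat `bsd-line-cycu-p1`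
(prover seat 1/3, K1 base), helper toward crux K1 (stmt-BirchSwinnertonDyer-21580). THEOREMS ONLY (no
definition, no named fact, no `sorry`); BSD is not proved by this file and no crux is.

WHAT IT CERTIFIES (memo `Cruxes/PSRankOneLowerHalfAtThree/K1-NEAREST-PRINT-v2.md` §2, the "why it might
fail" of the conjunct GZ₃). On a principal-series row the finite-slope object of the route is the untwist
`g = f_E ⊗ η̄` (`η` a PRIMITIVE Dirichlet character mod `9`, as in D1
`Literature.NumberTheory.IwasawaTheory.IsPSCyclotomicLFunctionOf`): a newform of weight `2`, level `9M`,
nebentypus `η̄²`, `U₃`-slope `½`. Its weight-character `κ_g : ℤ₃^× → ℂ₃^×`, `x ↦ x² η̄²(x)`, evaluated at the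
topological generator `γ = 4` of `Γ = 1 + 3ℤ₃` (the tree's `cyclotomicGenerator 3`), is
`κ_g(γ) = 16 · η(4)⁻² = 16 · ζ` with `ζ = η(4)` a PRIMITIVE cube root of unity (`η` primitive mod `9` ⟺
`η(4) ≠ 1`, and `η(4)³ = η(64) = η(1) = 1`; cycu-p2's `CyclotomicUntwistValueAtOne.eta_four_ne_one`). A
classical weight `k` (trivial nebentypus at `3`) has `κ_k(γ) = 4^k`. The weight-space coordinate is
`w(κ) = κ(γ) − 1` and the distance of two weights is `‖κ(γ) − κ′(γ)‖₃`. THIS FILE PROVES, in `ℂ₃ = ℂ_[3]`: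
* §1 `norm_sub_one_sq_of_isPrimitiveCubeRoot`: `ζ² + ζ + 1 = 0 ⇒ ‖ζ − 1‖² = 3⁻¹` — from the identity
  `(ζ − 1)² = −3ζ` and `‖ζ‖ = 1`; no extension theory is used;
* §2 `norm_sixteen_mul_sub_four_pow`: `‖16ζ − 4^k‖ = (√3)⁻¹` for EVERY `k : ℕ` (ultrametric: `16ζ − 4^k =
  16(ζ − 1) + (16 − 4^k)` with `‖16 − 4^k‖ ≤ 3⁻¹ < 3^{-1/2}`), while `norm_four_pow_sub_four_pow_le`:
  `‖4^j − 4^k‖ ≤ 3⁻¹` — classical weights are `3⁻¹`-close to one another, the point `16ζ` is `3^{-1/2}`-far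
  from all of them; `norm_sixteen_mul_sub_one`: `‖w(κ_g)‖ = ‖16ζ − 1‖ = (√3)⁻¹ ∈ (3⁻¹, 1)`, i.e. `κ_g` lies
  in the open annulus `3⁻¹ < ‖w‖ < 1` — the SPECTRAL HALO of the `p = 3` weight space — whereas every
  classical weight has `‖w‖ ≤ 3⁻¹` (`norm_four_pow_sub_one_le`);
* §3 the same read on the route's character: for `η : DirichletCharacter ℂ_[3] (3^2)` primitive,
  `norm_untwistWeight_sub_classical`: `‖4² · (η 4)⁻¹ ^ 2 − 4^k‖ = (√3)⁻¹` for all `k`, and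
  `untwistWeight_mem_halo`: `3⁻¹ < ‖4² · (η 4)⁻¹ ^ 2 − 1‖ < 1`; hence (`no_classical_weight_within`) no
  closed disc of radius `< (√3)⁻¹` about `κ_g` contains a classical weight.
CONSEQUENCE (docstring-level, the dictionary is standard): Büyükboduk–Pollack–Sasaki 2018 Thm 1.1.11
(`p`-adic Gross–Zagier at a non-θ-critical point of the eigencurve) asks for "a neighborhood with a dense
set of crystalline classical points"; crystalline classical points have classical weights, so NO affinoid
disc about `κ_g` of radius `< 3^{-1/2}` contains any — the family would have to be finite flat over a disc
reaching the centre `‖w‖ ≤ 3⁻¹` of weight space. This is the precise sense in which the printed formula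
does not reach the untwist; nothing else is claimed.

References: [cite: BuyukbodukPollackSasaki2018, Thm 1.1.11 (hypothesis "dense set of crystalline classical
points")]; weight space / halo vocabulary [folklore] (Coleman–Mazur; the `T`-coordinate `w = κ(γ) − 1`);
`η(4)` primitive cube root [folklore].
-/

noncomputable section

open DirichletCharacter IsUltrametricDist

-- single-conjunct summit: `Summit.BirchSwinnertonDyer.BirchSwinnertonDyer.…` repeats the name by design
set_option linter.dupNamespace false
set_option autoImplicit false

namespace Summit.BirchSwinnertonDyer.BirchSwinnertonDyer.Theorems.PSWeightHalo

/-! ### §0 `3`-adic sizes of integers inside `ℂ₃` -/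

/-- `‖3‖ = 3⁻¹` in `ℂ₃`. [folklore] -/
theorem norm_three : ‖(3 : ℂ_[3])‖ = (3 : ℝ)⁻¹ := by
  have h : ‖((3 : ℕ) : ℂ_[3])‖ = ((3 : ℕ) : ℝ)⁻¹ := by
    rw [← map_natCast (algebraMap ℚ_[3] ℂ_[3]) 3, norm_algebraMap', Padic.norm_p]
  simpa using h

/-- An integer has `3`-adic size `≤ 1` in `ℂ₃`. [folklore] -/
theorem norm_intCast_le_one (m : ℤ) : ‖(m : ℂ_[3])‖ ≤ 1 := by
  rw [← map_intCast (algebraMap ℚ_[3] ℂ_[3]) m, norm_algebraMap']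
  exact Padic.norm_int_le_one m

/-- An integer prime to `3` is a `3`-adic unit: `‖m‖ = 1` in `ℂ₃`. [folklore] -/
theorem norm_intCast_eq_one_of_not_dvd {m : ℤ} (hm : ¬ (3 : ℤ) ∣ m) : ‖(m : ℂ_[3])‖ = 1 := by
  rw [← map_intCast (algebraMap ℚ_[3] ℂ_[3]) m, norm_algebraMap']
  refine le_antisymm (Padic.norm_int_le_one m) (not_lt.mp fun h ↦ hm ?_)
  exact_mod_cast (Padic.norm_intCast_lt_one_iff (p := 3)).mp h

/-- A multiple of `3` has `3`-adic size `≤ 3⁻¹` in `ℂ₃`. [folklore] -/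
theorem norm_intCast_le_of_dvd {m : ℤ} (hm : (3 : ℤ) ∣ m) : ‖(m : ℂ_[3])‖ ≤ (3 : ℝ)⁻¹ := by
  obtain ⟨n, rfl⟩ := hm
  rw [Int.cast_mul, norm_mul, show ((3 : ℤ) : ℂ_[3]) = 3 by norm_num, norm_three]
  exact mul_le_of_le_one_right (by norm_num) (norm_intCast_le_one n)

/-- `‖16‖ = 1` in `ℂ₃`. [folklore] -/
theorem norm_sixteen : ‖(16 : ℂ_[3])‖ = 1 := by
  have h := norm_intCast_eq_one_of_not_dvd (m := 16) (by decide)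
  simpa using h

/-- `3 ∣ 4^k − 1`. [folklore] -/
theorem three_dvd_four_pow_sub_one (k : ℕ) : (3 : ℤ) ∣ 4 ^ k - 1 := by
  have h := sub_dvd_pow_sub_pow (4 : ℤ) 1 k
  simpa using h

/-- Classical weights are `3⁻¹`-close to each other: `‖4^j − 4^k‖ ≤ 3⁻¹` in `ℂ₃`
(`4 ≡ 1 (mod 3)`; `κ_k(γ) = 4^k` at the generator `γ = 4` of `1 + 3ℤ₃`). [folklore] -/
theorem norm_four_pow_sub_four_pow_le (j k : ℕ) : ‖(4 : ℂ_[3]) ^ j - 4 ^ k‖ ≤ (3 : ℝ)⁻¹ := by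
  have hdvd : (3 : ℤ) ∣ 4 ^ j - 4 ^ k := by
    have := (three_dvd_four_pow_sub_one j).sub (three_dvd_four_pow_sub_one k)
    simpa using this
  have h := norm_intCast_le_of_dvd hdvd
  simpa using h

/-- In the `T`-coordinate `w = κ(γ) − 1`: every classical weight has `‖w‖ = ‖4^k − 1‖ ≤ 3⁻¹`. [folklore] -/
theorem norm_four_pow_sub_one_le (k : ℕ) : ‖(4 : ℂ_[3]) ^ k - 1‖ ≤ (3 : ℝ)⁻¹ := by
  simpa using norm_four_pow_sub_four_pow_le k 0

/-- `‖16 − 4^k‖ ≤ 3⁻¹` (`16 = 4²`). [folklore] -/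
theorem norm_sixteen_sub_four_pow_le (k : ℕ) : ‖(16 : ℂ_[3]) - 4 ^ k‖ ≤ (3 : ℝ)⁻¹ := by
  have h := norm_four_pow_sub_four_pow_le 2 k
  rwa [show ((4 : ℂ_[3]) ^ 2) = 16 by norm_num] at h

/-! ### §1 Primitive cube roots of unity in `ℂ₃`: `‖ζ − 1‖² = 3⁻¹` -/

section CubeRoot

variable {ζ : ℂ_[3]}

/-- A root of unity has norm `1`. [folklore] -/
theorem norm_eq_one_of_pow_eq_one {n : ℕ} (hn : n ≠ 0) (h : ζ ^ n = 1) : ‖ζ‖ = 1 := by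
  have h1 : ‖ζ‖ ^ n = 1 := by rw [← norm_pow, h, norm_one]
  exact (pow_eq_one_iff_of_nonneg (norm_nonneg _) hn).mp h1

/-- The key identity: `(ζ − 1)² = −3ζ` for a primitive cube root of unity. [folklore] -/
theorem sub_one_sq_of_isPrimitiveCubeRoot (h : ζ ^ 2 + ζ + 1 = 0) : (ζ - 1) ^ 2 = -3 * ζ := by
  linear_combination h

/-- **`‖ζ − 1‖² = 3⁻¹`**: a primitive cube root of unity is at `3`-adic distance `3^{-1/2}` from `1`
(`(ζ − 1)² = −3ζ`, `‖ζ‖ = 1`; equivalently `(1 − ζ)` is a uniformiser of `ℚ₃(ζ₃)`, `e = 2`). [folklore] -/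
theorem norm_sub_one_sq_of_isPrimitiveCubeRoot (h : ζ ^ 2 + ζ + 1 = 0) : ‖ζ - 1‖ ^ 2 = (3 : ℝ)⁻¹ := by
  -- `ζ³ = 1` (the tree has this one-liner as `Literature.IUT.LogVolume.DyadicCyclotomic.zeta_cube`; inlined)
  have h3 : ζ ^ 3 = 1 := by linear_combination (ζ - 1) * h
  rw [← norm_pow, sub_one_sq_of_isPrimitiveCubeRoot h, norm_mul, norm_neg, norm_three,
    norm_eq_one_of_pow_eq_one three_ne_zero h3, mul_one]

/-- `‖ζ − 1‖ = (√3)⁻¹`. [folklore] -/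
theorem norm_sub_one_of_isPrimitiveCubeRoot (h : ζ ^ 2 + ζ + 1 = 0) : ‖ζ - 1‖ = (Real.sqrt 3)⁻¹ := by
  have hsq := norm_sub_one_sq_of_isPrimitiveCubeRoot h
  have hnn : 0 ≤ ‖ζ - 1‖ := norm_nonneg _
  rw [← Real.sqrt_inv, ← hsq, Real.sqrt_sq hnn]

/-- `3⁻¹ < (√3)⁻¹`. [folklore] -/
theorem inv_three_lt_inv_sqrt_three : (3 : ℝ)⁻¹ < (Real.sqrt 3)⁻¹ := by
  have h3 : Real.sqrt 3 < 3 := by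
    rw [show (3 : ℝ) = Real.sqrt 9 by rw [show (9 : ℝ) = 3 ^ 2 by norm_num, Real.sqrt_sq (by norm_num)]]
    exact Real.sqrt_lt_sqrt (by norm_num) (by norm_num)
  have hpos : 0 < Real.sqrt 3 := Real.sqrt_pos.mpr (by norm_num)
  exact (inv_lt_inv₀ (by norm_num) hpos).mpr h3

/-- `(√3)⁻¹ < 1`. [folklore] -/
theorem inv_sqrt_three_lt_one : (Real.sqrt 3)⁻¹ < 1 := by
  have h1 : 1 < Real.sqrt 3 := by
    rw [show (1 : ℝ) = Real.sqrt 1 by simp]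
    exact Real.sqrt_lt_sqrt (by norm_num) (by norm_num)
  exact inv_lt_one_of_one_lt₀ h1

/-! ### §2 The halo distance: `‖16ζ − 4^k‖ = (√3)⁻¹` for every classical weight `k` -/

/-- **`‖16ζ − 4^k‖ = (√3)⁻¹` for every `k : ℕ`** — the weight-character value `κ_g(γ) = 16ζ` of the
untwist is at `3`-adic distance EXACTLY `3^{-1/2}` from every classical weight `κ_k(γ) = 4^k`:
`16ζ − 4^k = 16(ζ − 1) + (16 − 4^k)`, `‖16(ζ − 1)‖ = (√3)⁻¹ > 3⁻¹ ≥ ‖16 − 4^k‖`, and `ℂ₃` is ultrametric.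
[folklore] -/
theorem norm_sixteen_mul_sub_four_pow (h : ζ ^ 2 + ζ + 1 = 0) (k : ℕ) :
    ‖16 * ζ - 4 ^ k‖ = (Real.sqrt 3)⁻¹ := by
  have hd : ‖(16 : ℂ_[3]) * (ζ - 1)‖ = (Real.sqrt 3)⁻¹ := by
    rw [norm_mul, norm_sixteen, one_mul, norm_sub_one_of_isPrimitiveCubeRoot h]
  have hr : ‖(16 : ℂ_[3]) - 4 ^ k‖ < ‖(16 : ℂ_[3]) * (ζ - 1)‖ :=
    hd ▸ (norm_sixteen_sub_four_pow_le k).trans_lt inv_three_lt_inv_sqrt_three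
  have hsplit : (16 : ℂ_[3]) * ζ - 4 ^ k = 16 * (ζ - 1) + (16 - 4 ^ k) := by ring
  rw [hsplit, norm_add_eq_max_of_norm_ne_norm (ne_of_gt hr), max_eq_left hr.le, hd]

/-- The same for `ζ⁻¹ = ζ²` (the other primitive cube root): `‖16ζ² − 4^k‖ = (√3)⁻¹`. [folklore] -/
theorem norm_sixteen_mul_sq_sub_four_pow (h : ζ ^ 2 + ζ + 1 = 0) (k : ℕ) :
    ‖16 * ζ ^ 2 - 4 ^ k‖ = (Real.sqrt 3)⁻¹ := by
  have h' : (ζ ^ 2) ^ 2 + ζ ^ 2 + 1 = 0 := by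
    linear_combination (ζ ^ 2 - ζ + 1) * h
  exact norm_sixteen_mul_sub_four_pow h' k

/-- **`κ_g` lies in the spectral halo**: in the `T`-coordinate, `‖w(κ_g)‖ = ‖16ζ − 1‖ = (√3)⁻¹`, which is
in the open annulus `(3⁻¹, 1)`, while classical weights have `‖w‖ ≤ 3⁻¹` (`norm_four_pow_sub_one_le`).
[folklore] -/
theorem norm_sixteen_mul_sub_one (h : ζ ^ 2 + ζ + 1 = 0) : ‖16 * ζ - 1‖ = (Real.sqrt 3)⁻¹ := by
  simpa using norm_sixteen_mul_sub_four_pow h 0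

/-- No closed disc of radius `r < (√3)⁻¹` about `16ζ` contains a classical weight `4^k`. [folklore] -/
theorem not_norm_sub_four_pow_le (h : ζ ^ 2 + ζ + 1 = 0) {r : ℝ} (hr : r < (Real.sqrt 3)⁻¹) (k : ℕ) :
    ¬ ‖16 * ζ - 4 ^ k‖ ≤ r := by
  rw [norm_sixteen_mul_sub_four_pow h k, not_le]
  exact hr

end CubeRoot

/-! ### §3 On the route's character: `η` primitive mod `9`, `ζ = η(4)` -/

section Untwist

variable (η : DirichletCharacter ℂ_[3] (3 ^ 2))

/-- `η(4)³ = 1` (`4³ = 64 ≡ 1 mod 9`). [folklore] -/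
theorem eta_four_pow_three : η ((4 : ℕ) : ZMod (3 ^ 2)) ^ 3 = 1 := by
  have h : ((4 : ℕ) : ZMod (3 ^ 2)) ^ 3 = 1 := by decide
  rw [← map_pow, h, map_one]

/-- **For `η` PRIMITIVE mod `9`, `ζ = η(4)` is a primitive cube root of unity: `ζ² + ζ + 1 = 0`**
(`η(4) = z²` with `z = η(2)` and `1 + z² + z⁴ = 0`, cycu-p2's `one_add_sq_add_fourth_eq_zero`). [folklore] -/
theorem eta_four_isPrimitiveCubeRoot (hη : η.IsPrimitive) :
    η ((4 : ℕ) : ZMod (3 ^ 2)) ^ 2 + η ((4 : ℕ) : ZMod (3 ^ 2)) + 1 = 0 := by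
  obtain ⟨-, -, e4, -, -, -, -⟩ := CyclotomicUntwistValueAtOne.eta_table η
  have h := CyclotomicUntwistValueAtOne.one_add_sq_add_fourth_eq_zero η hη
  rw [e4]
  linear_combination h

/-- The nebentypus factor of the untwist at `γ = 4`: `η̄²(4) = (η 4)⁻¹ ^ 2 = η(4)` (since `η(4)³ = 1`).
[folklore] -/
theorem eta_four_inv_sq (hη : η.IsPrimitive) :
    (η ((4 : ℕ) : ZMod (3 ^ 2)))⁻¹ ^ 2 = η ((4 : ℕ) : ZMod (3 ^ 2)) := by
  have h3 := eta_four_pow_three η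
  have hne : η ((4 : ℕ) : ZMod (3 ^ 2)) ≠ 0 := fun h0 ↦ by
    rw [h0, zero_pow three_ne_zero] at h3
    exact zero_ne_one h3
  have _ := hη
  rw [inv_pow, inv_eq_iff_eq_inv, eq_comm, inv_eq_of_mul_eq_one_right]
  linear_combination h3

/-- **The untwist's weight-character is `3^{-1/2}`-far from every classical weight.** For `η` primitive
mod `9`, the weight-`2`, nebentypus-`η̄²` character `κ_g(x) = x² η̄(x)²` at `γ = 4` is `4² · (η 4)⁻¹ ^ 2`, and
`‖4² · (η 4)⁻¹ ^ 2 − 4^k‖ = (√3)⁻¹` for every `k : ℕ`. [cite: BuyukbodukPollackSasaki2018, Thm 1.1.11 (hypothesis: a neighbourhood with a dense set of crystalline classical points)] -/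
theorem norm_untwistWeight_sub_classical (hη : η.IsPrimitive) (k : ℕ) :
    ‖(4 : ℂ_[3]) ^ 2 * (η ((4 : ℕ) : ZMod (3 ^ 2)))⁻¹ ^ 2 - 4 ^ k‖ = (Real.sqrt 3)⁻¹ := by
  rw [eta_four_inv_sq η hη, show ((4 : ℂ_[3]) ^ 2) = 16 by norm_num]
  exact norm_sixteen_mul_sub_four_pow (eta_four_isPrimitiveCubeRoot η hη) k

/-- **The untwist lies in the spectral halo** `3⁻¹ < ‖w‖ < 1` of the `3`-adic weight space
(`w = κ(γ) − 1`), where no classical weight lives (`‖w(k)‖ ≤ 3⁻¹`, `norm_four_pow_sub_one_le`). [folklore] -/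
theorem untwistWeight_mem_halo (hη : η.IsPrimitive) :
    (3 : ℝ)⁻¹ < ‖(4 : ℂ_[3]) ^ 2 * (η ((4 : ℕ) : ZMod (3 ^ 2)))⁻¹ ^ 2 - 1‖ ∧
      ‖(4 : ℂ_[3]) ^ 2 * (η ((4 : ℕ) : ZMod (3 ^ 2)))⁻¹ ^ 2 - 1‖ < 1 := by
  have h := norm_untwistWeight_sub_classical η hη 0
  rw [pow_zero] at h
  rw [h]
  exact ⟨inv_three_lt_inv_sqrt_three, inv_sqrt_three_lt_one⟩

/-- **No small neighbourhood of the untwist contains a classical weight**: for every radius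
`r < (√3)⁻¹` and every `k`, `‖κ_g(γ) − 4^k‖ > r`. In particular no disc of radius `< 3^{-1/2}` about the
untwist on the eigencurve has a dense (or any) set of crystalline classical points — the hypothesis of
Büyükboduk–Pollack–Sasaki 2018 Thm 1.1.11 fails for every such neighbourhood. [cite: BuyukbodukPollackSasaki2018, Thm 1.1.11] -/
theorem no_classical_weight_within (hη : η.IsPrimitive) {r : ℝ} (hr : r < (Real.sqrt 3)⁻¹) (k : ℕ) :
    r < ‖(4 : ℂ_[3]) ^ 2 * (η ((4 : ℕ) : ZMod (3 ^ 2)))⁻¹ ^ 2 - 4 ^ k‖ := by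
  rw [norm_untwistWeight_sub_classical η hη k]
  exact hr

end Untwist

end Summit.BirchSwinnertonDyer.BirchSwinnertonDyer.Theorems.PSWeightHalo
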